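import Summits.QuantumFields.BalabanUV.T4Continuum.Support.NE7CriticalTensionLetter
import HarnessLib

/-!
# NE7TensionLetterOfRadius — THE INTEGRATED TENSION LETTER FROM THE POINTWISE (1.9)-TYPE RADIUS: for a unitary `P`-periodic `U` with `SmallField U a` (`a ≤ 1∕4`) whose tension
# `T_ν(x) = Σ_μ ∇_μ^† B_{μν}(x)` (covariant codifferential of the antisymmetrised flux form) is bounded by `T₀` at every bond, the first variation obeys
# `|dAction U ψ (perWin d P)| ≤ (T₀ + 12·#Plane·a²)·‖ψ‖_{ℓ¹(periodBox P)}` for EVERY skew `P`-periodic `ψ` — the hypothesis `hten` (`τ_W`) of F137∕F139 from a class datum of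
# [B8] (1.9) type, with `τ_W = T₀ + 12·#Plane·x² ≍ c∕M³ + b²∕M⁴` in the class currencies (file 70 of the curved (APE))

Cell `pub-balaban`, rung (B)+1 sub-cell t4, lineage `b2b-balaban-t4-ne7-p1` (CRUX PROVER NE7 #1 = OWNER of row NE7), generation 80; memo
`t4/b2b-balaban-t4-ne7-p1-g80/SLICE-LETTER-OBSTRUCTION.md` §8.  File F140, over gen 62's `NE7ExactCurrent.dAction_sub_tension_pairing_le` (the exact first variation is the tension
pairing up to `12·#Plane·a²·‖ψ‖₁`), `NE3CovariantCalculus.abs_hsR_le`, `AveragingDeficitTransport.norm_Ad_of_unitary` (`frame` is isometric).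
WHY.  F139 reduced the repaired slice-solver letter to (c₁)^∞, (c₂)^∞ and the integrated tension letter `|dAction W K| ≤ τ_W‖K‖₁` for ALL skew periodic `K` (not only tangent ones: the
commutator directions `Yξ⁺ − ξ⁺Y` of F133 are not tangent).  R1∕R2 (`NE7CriticalFirstVariation`, `NE7CriticalTensionLetter`) give it at a FLAT top; THIS file gives it at ANY
background from the pointwise tension radius — the (1.9)-type class datum that road (B) already displays (`j_W` of F123, `g_W` of F123d through row NE3's flux-gradient dictionary),
so `hten` is no new letter in kind.  Currency: `T₀ ≍ c∕M³`, `12·#Plane·x² ≍ b²∕M⁴` ⇒ `K_G·τ_W·2d(M−1)C_H ≍ 2dC_H·K·c∕M` in F137's `K_X′` — the closing order.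
WHAT ([folklore]; 0 def, 0 sorry).  **`abs_dAction_le_of_tension_sup`**.
HONEST FRAMING (page 1): elementary bookkeeping at one configuration over a displayed pointwise radius; nothing of Bałaban's asserted ((1.9) is the TYPE of the datum, not his sentence);
NOT ONE-STEP, NOT NE7; spine 0∕9; finite T⁴ rung (B)+1 — NOT infinite volume, NOT mass gap, NOT `BetaPertH`, NOT Clay.  Continuum YM on T⁴ ⇐ BetaPertH ∧ nine spine estimates (0/9
proved); BetaPertH ⇐ (D1) ∧ (D4) ∧ CAP+tail; G-an2-4 gates asym, D1 and NE2/3/4.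
-/

set_option autoImplicit false

open scoped BigOperators Matrix Matrix.Norms.L2Operator
open NormedSpace Finset

namespace Summit.QuantumFields.BalabanUV.T4Continuum.NE7TensionLetterOfRadius

open Literature.MathematicalPhysics.QuantumFieldTheory.Balaban1983to89
open B7Prop1Explicit B7Prop2Explicit MatrixLog UnitaryModel
open T4AveragingDeficitWall (IsUnitaryCfg IsSkewDir SmallField dirL1 Ad flux)
open T4AveragingDeficitWallBoundary (IsPeriodicCfg periodBox)
open AveragingDeficitPeriodicCounting (IsPeriodicDir)
open MinimalActionLevels (perWin)
open NE3HessForm (dAction)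
open NE3CovariantCalculus (hsR cDstar abs_hsR_le)
open NE3CovariantWeitzenbock (frame)
open AveragingDeficitTransport (norm_Ad_of_unitary)
open NE7ExactCurrent (dAction_sub_tension_pairing_le)
open NE7CriticalTensionLetter (plaqsOf_periodBox)

noncomputable section

variable {d : ℕ} {n : Type*} [Fintype n] [DecidableEq n]

/-- **THE INTEGRATED TENSION LETTER FROM THE POINTWISE TENSION RADIUS**: `P ≥ 1`, `U` unitary `P`-periodic, `SmallField U a` with `0 ≤ a ≤ 1∕4`, `B` the antisymmetrised flux form,
`‖Σ_μ cDstar U μ (B · μ ν) x‖ ≤ T₀` at every bond ⟹ for every skew `P`-periodic `ψ`: `|dAction U ψ (perWin d P)| ≤ (T₀ + 12·#Plane·a²)·dirL1 ψ (periodBox P)`. [folklore] -/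
theorem abs_dAction_le_of_tension_sup [Nonempty n] {P : ℕ} (hP : 1 ≤ P) {U : Site d → Fin d → (Matrix n n ℂ)ˣ} (hU : IsUnitaryCfg U) (hUP : IsPeriodicCfg U (P : ℤ))
    {a : ℝ} (ha0 : 0 ≤ a) (ha : a ≤ 1 / 4) (hUa : SmallField U a)
    {B : Site d → Fin d → Fin d → Matrix n n ℂ}
    (hBF : ∀ (x : Site d) (μ ν : Fin d) (h : μ < ν), B x μ ν = flux U (x, ⟨(μ, ν), h⟩))
    (hanti : ∀ (x : Site d) (μ ν : Fin d), B x ν μ = -B x μ ν)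
    {T₀ : ℝ} (hT : ∀ (x : Site d) (ν : Fin d), ‖∑ μ : Fin d, cDstar U μ (fun y => B y μ ν) x‖ ≤ T₀)
    {ψ : Site d → Fin d → Matrix n n ℂ} (hψs : IsSkewDir ψ) (hψP : IsPeriodicDir ψ (P : ℤ)) :
    |dAction U ψ (perWin d P)| ≤ (T₀ + 12 * (Fintype.card (T4AveragingDeficitWall.Plane d) : ℝ) * a ^ 2) * dirL1 ψ (periodBox (d := d) P) := by
  have h1 := dAction_sub_tension_pairing_le hP hU hUP ha0 ha hUa hψs hψP hBF hanti
  rw [plaqsOf_periodBox] at h1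
  -- the pairing is bounded by `T₀·‖ψ‖₁` (the frame is isometric)
  have hpair : |∑ x ∈ periodBox (d := d) P, ∑ ν : Fin d, hsR (frame U ψ x ν) (∑ μ : Fin d, cDstar U μ (fun y => B y μ ν) x)|
      ≤ T₀ * dirL1 ψ (periodBox (d := d) P) := by
    unfold T4AveragingDeficitWall.dirL1
    rw [Finset.mul_sum]
    refine (Finset.abs_sum_le_sum_abs _ _).trans (Finset.sum_le_sum fun x _ => ?_)
    rw [Finset.mul_sum]
    refine (Finset.abs_sum_le_sum_abs _ _).trans (Finset.sum_le_sum fun ν _ => ?_)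
    have hfr : ‖frame U ψ x ν‖ = ‖ψ x ν‖ := norm_Ad_of_unitary (hU x ν) _
    calc |hsR (frame U ψ x ν) (∑ μ : Fin d, cDstar U μ (fun y => B y μ ν) x)|
        ≤ ‖frame U ψ x ν‖ * ‖∑ μ : Fin d, cDstar U μ (fun y => B y μ ν) x‖ := abs_hsR_le _ _
      _ ≤ ‖ψ x ν‖ * T₀ := by rw [hfr]; exact mul_le_mul_of_nonneg_left (hT x ν) (norm_nonneg _)
      _ = T₀ * ‖ψ x ν‖ := mul_comm _ _
  have htri : |dAction U ψ (perWin d P)|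
      ≤ |∑ x ∈ periodBox (d := d) P, ∑ ν : Fin d, hsR (frame U ψ x ν) (∑ μ : Fin d, cDstar U μ (fun y => B y μ ν) x)|
        + |dAction U ψ (perWin d P) - ∑ x ∈ periodBox (d := d) P, ∑ ν : Fin d, hsR (frame U ψ x ν) (∑ μ : Fin d, cDstar U μ (fun y => B y μ ν) x)| := by
    have := abs_add_le (∑ x ∈ periodBox (d := d) P, ∑ ν : Fin d, hsR (frame U ψ x ν) (∑ μ : Fin d, cDstar U μ (fun y => B y μ ν) x))
      (dAction U ψ (perWin d P) - ∑ x ∈ periodBox (d := d) P, ∑ ν : Fin d, hsR (frame U ψ x ν) (∑ μ : Fin d, cDstar U μ (fun y => B y μ ν) x))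
    rwa [add_sub_cancel] at this
  calc |dAction U ψ (perWin d P)| ≤ T₀ * dirL1 ψ (periodBox (d := d) P) + 12 * (Fintype.card (T4AveragingDeficitWall.Plane d) : ℝ) * a ^ 2 * dirL1 ψ (periodBox (d := d) P) :=
        htri.trans (add_le_add hpair h1)
    _ = (T₀ + 12 * (Fintype.card (T4AveragingDeficitWall.Plane d) : ℝ) * a ^ 2) * dirL1 ψ (periodBox (d := d) P) := by ring

end

end Summit.QuantumFields.BalabanUV.T4Continuum.NE7TensionLetterOfRadius
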